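import Literature.AlgebraicGeometry.AbelianSchemes.WeilPairingHom
import Literature.AlgebraicGeometry.AbelianSchemes.AbelianSchemeDualPairNormalize
import Literature.AlgebraicGeometry.Motives.AbelianVarietyFrobeniusKernelAnnihilator
import HarnessLib

/-!
# The Weil isomorphism `Â[q] ≅ (A[q])^D` under `dim Â = dim A` ([Mumford AV] §15 Thm. 1, §20 p. 184)

Topic `Literature/AlgebraicGeometry/AbelianSchemes`; namespace `Literature.AlgebraicGeometry.AbelianSchemes.WeilPairing`.  THEOREMS ONLY (no definition,
no named fact, no instance, no notation, no `sorry`).  Cell `hodgecm-mathlib` (D-0151), FLOOR 0, P6 «MOD programme» (crux hLiu418 = stmt-HodgeConjecture-24832),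
W-line `Cruxes/HLiu418/Lines/F0_P6b_WeilCartierDuality.lean` letter `stub_W1` «WeilPairingNatural», σ1 road step **(σ1-f3)** — the last step of the
assembly (sequel of ★ (σ1-f2) `WeilPairingHom`).  LEAD F0P6-plan (g2) RULING M-17v′ (2026-09-01): the W-line family TYPE `WeilFamily` carries the binder
`hdim : dim Â = dim A` (the equality for an abstract dual pair in characteristic `p` is not in the tree, ★ `DualIsogenyDegree` docstring; the consumer
supplies it from relative-dimension constancy), so the isomorphism is proved HERE under `hdim`.  The W-line՚s `stub_W1` is then `Classical.choose` of
`exists_weilIso'` (at `D` if normalised, at ★ `D.normalize` otherwise) + ★ `weilHom_natural`.  HC_CM is proved only modulo the printed citations until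
rung 0 closes; nothing here is about HC.

THE PRINT.  [MumfordAV1970] §20 p. 184: «`X̂_n → Hom(X_n, 𝔾_m)` is injective; since both groups have order `n^{2g}` it is an isomorphism»; §15 Thm. 1 (p. 143):
`Ker f̂ ≅ (Ker f)^D` (for `f = [n]`).  Scheme-theoretically: the monomorphism `w : Â[q] ↪ (A[q])^D` of ★ (σ1-f2) between finite `k`-group schemes of the same
rank `q^{2 dim A} = q^{2 dim Â}` is an isomorphism.

* §1 **`isIso_weilHom`** — trivial kernel (★ `eq_one_of_comp_weilHom_eq_one`) + `rk Γ(Ĝ) = rk Γ(G)` ⇒ `IsIso w` (★ B-p04 `isIso_of_forall_comp_eq_one_of_finrank_alg_eq`);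
* §2 `finrank_alg_eq_of_dim_eq` — `rk Γ(Ĝ) = rk Γ(G)` from `hdim` (`q = p^r`; ★ `finrank_alg_eq_of_realises_torsion` ×2: `rk Γ(A[q]) = q^{2 dim A}`);
  **`exists_weilIso`** — an ISOMORPHISM of group schemes `e : Ĝ ≅ G^D`, a homomorphism, with pairing values the Weil characters `⟪y ≫ e, x⟫ = e_q(x ≫ j, y ≫ ĵ)`;
* §3 **`exists_weilIso'`** — the same with the W-line binders (`j`, `ĵ` closed immersions; `Mono` derived).

## References
* [MumfordAV1970] D. Mumford, *Abelian Varieties* (1970), §15 Thm. 1 (p. 143), §20 (pp. 184–186), §6 Application 3 (p. 63).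
* [Tate1997FiniteFlatGroupSchemes] J. Tate, *Finite flat group schemes* (1997), §(3.7)–(3.8) pp. 145–146.
* [GortzWedhorn2023] U. Görtz, T. Wedhorn, *Algebraic Geometry II* (2023), Prop. 27.186 (p. 887).
-/

set_option autoImplicit false

noncomputable section

-- `TopCat.Presheaf`/`Scheme.Modules` and the `Over`/`Scheme` wrappers are not reducible (as in ★ `WeilUnitOfTorsionPoint`, ★ `GroupSchemes/*`).
set_option backward.isDefEq.respectTransparency false

universe u

open CategoryTheory CategoryTheory.Limits AlgebraicGeometry MonoidalCategory CartesianMonoidalCategory TopologicalSpace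
  Opposite
open scoped MonObj

namespace Literature.AlgebraicGeometry.AbelianSchemes.WeilPairing

open Literature.AlgebraicGeometry.GroupSchemes Literature.AlgebraicGeometry.GroupSchemes.AffineGroupScheme
open Literature.AlgebraicGeometry.Motives Literature.AlgebraicGeometry.Motives.AbelianVariety
open Literature.AlgebraicGeometry.AbelianSchemes.AbelianSchemeOver Literature.AlgebraicGeometry.AbelianSchemes.AbelianSchemeOver.DualPair
open scoped CategoryTheory.Obj

variable {k : Type u} [Field k]

/-! ## §1 Equal ranks ⇒ the Weil homomorphism is an isomorphism -/

section Iso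

variable (n : ℕ) (A : AbelianVariety k) (D : (AbelianScheme.ofAbelianVariety A).toOver.DualPair)
  (hD : Nonempty ((Scheme.Modules.pullback (DualPair.unitHatSlice D)).obj D.P ≅ SheafOfModules.unit _))
  (G : SchemeOver k) [GrpObj G] [IsCommMonObj G] [IsAffine G.left] [Module.Free k (Alg G)] [Module.Finite k (Alg G)]
  (j : G ⟶ A.X)
  (hG : ∀ ⦃T : SchemeOver k⦄ (t : T ⟶ A.X), (∃ s : T ⟶ G, s ≫ j = t) ↔ t ≫ ((((n : ℕ) : ℤ) • 𝟙 A).hom.hom.hom) = 1)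
  (Ĝ : SchemeOver k) [GrpObj Ĝ] [IsAffine Ĝ.left] [Module.Finite k (Alg Ĝ)]
  (ĵ : Ĝ ⟶ D.hat.X) [IsMonHom ĵ]
  (hĜ : ∀ ⦃T : SchemeOver k⦄ (t : T ⟶ D.hat.X),
    (∃ s : T ⟶ Ĝ, s ≫ ĵ = t) ↔ t ≫ ((((n : ℕ) : ℤ) • 𝟙 D.hat.toAffine.toAbelianVariety).hom.hom.hom) = 1)

include hD hG hĜ in
/-- **EQUAL RANKS ⇒ THE WEIL HOMOMORPHISM `w : Ĝ → G^D` IS AN ISOMORPHISM** (`n ≠ 0`): trivial kernel on finite points (★ (σ1-f2)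
`eq_one_of_comp_weilHom_eq_one`) + `dim_k Γ(Ĝ) = dim_k Γ(G)` ⇒ isomorphism (★ B-p04 `isIso_of_forall_comp_eq_one_of_finrank_alg_eq`: mono ⇒ closed
immersion ⇒ iso by ranks, `dim Γ(G^D) = dim Γ(G)`).  [MumfordAV1970] §20 p. 184: «`X̂_n → Hom(X_n, 𝔾_m)` is injective, and both have order `n^{2g}`».
[cite: MumfordAV1970, §20 (p. 184), §15 Thm. 1 (p. 143)] [cite: Tate1997FiniteFlatGroupSchemes, §(3.7)–(3.8) pp. 145–146] -/
theorem isIso_weilHom (hn : n ≠ 0) [Mono ĵ] (w : Ĝ ⟶ cartierDual G) [IsMonHom w]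
    (hw : ∀ ⦃T : Type u⦄ [CommRing T] [Algebra k T] [Module.Finite k T] (y : specOver k T ⟶ Ĝ) (x : specOver k T ⟶ G),
      cartierPairing G (y ≫ w) x =
        D.weilChar hD n (y ≫ ĵ) (comp_pow_eq_one' n A D Ĝ ĵ hĜ y) (x ≫ j) (comp_pow_eq_one n A G j hG x))
    (hrank : Module.finrank k (Alg Ĝ) = Module.finrank k (Alg G)) : IsIso w :=
  haveI : IsFinite Ĝ.hom := isFinite_hom_of_finite_alg Ĝ
  isIso_of_forall_comp_eq_one_of_finrank_alg_eq G w
    (fun _ _ _ _ y hy => eq_one_of_comp_weilHom_eq_one n A D hD G j hG Ĝ ĵ hĜ hn w hw y hy) hrank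

end Iso

/-! ## §2 `rk Γ(Ĝ) = rk Γ(G)` from `dim Â = dim A` (`q = p^r`); the packaged Weil isomorphism -/

section PrimePower

variable (p : ℕ) [Fact p.Prime] (r : ℕ) (A : AbelianVariety k) (D : (AbelianScheme.ofAbelianVariety A).toOver.DualPair)
  (hD : Nonempty ((Scheme.Modules.pullback (DualPair.unitHatSlice D)).obj D.P ≅ SheafOfModules.unit _))
  (hdim : D.hat.toAffine.toAbelianVariety.dim = A.dim)
  (G : SchemeOver k) [GrpObj G] [IsCommMonObj G] [IsAffine G.left] [Module.Free k (Alg G)] [Module.Finite k (Alg G)]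
  (j : G ⟶ A.X) [IsMonHom j] [Mono j]
  (hG : ∀ ⦃T : SchemeOver k⦄ (t : T ⟶ A.X), (∃ s : T ⟶ G, s ≫ j = t) ↔ t ≫ ((((p ^ r : ℕ) : ℤ) • 𝟙 A).hom.hom.hom) = 1)
  (Ĝ : SchemeOver k) [GrpObj Ĝ] [IsAffine Ĝ.left] [Module.Finite k (Alg Ĝ)]
  (ĵ : Ĝ ⟶ D.hat.X) [IsMonHom ĵ] [Mono ĵ]
  (hĜ : ∀ ⦃T : SchemeOver k⦄ (t : T ⟶ D.hat.X),
    (∃ s : T ⟶ Ĝ, s ≫ ĵ = t) ↔ t ≫ ((((p ^ r : ℕ) : ℤ) • 𝟙 D.hat.toAffine.toAbelianVariety).hom.hom.hom) = 1)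

omit [GrpObj G] [IsCommMonObj G] [Module.Free k (Alg G)] [Module.Finite k (Alg G)] [IsMonHom j] [GrpObj Ĝ] [Module.Finite k (Alg Ĝ)]
  [IsMonHom ĵ] in
include hG hĜ hdim in
/-- **`rk Γ(Ĝ) = rk Γ(G)` when `dim Â = dim A`**: both are `q^{2 dim}` (★ `finrank_alg_eq_of_realises_torsion`: `rk Γ(A[q]) = q^{2 dim A}`, from
`deg [q] = q^{2g}` ★ `kerRank_zsmul_id_holds`). [cite: MumfordAV1970, §6 Application 3 (p. 63), §20 (p. 184)] [cite: GortzWedhorn2023, Prop. 27.186 (p. 887)] -/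
theorem finrank_alg_eq_of_dim_eq : Module.finrank k (Alg Ĝ) = Module.finrank k (Alg G) := by
  rw [finrank_alg_eq_of_realises_torsion p r A G j hG,
    finrank_alg_eq_of_realises_torsion p r D.hat.toAffine.toAbelianVariety Ĝ ĵ hĜ, hdim]

include hdim hG hĜ in
/-- **THE WEIL ISOMORPHISM `Â[q] ≅ (A[q])^D`** ([MumfordAV1970] §15 Thm. 1 for `f = [q]`, §20 p. 184): for an abelian variety `A∕k`, a dual pair `D = (Â, 𝒫)` with
the unit hypothesis and `dim Â = dim A`, and realisations `j : G ↪ A` of `A[q]`, `ĵ : Ĝ ↪ Â` of `Â[q]` (`q = p^r`, all-`T` points), there is an ISOMORPHISM of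
group schemes `e : Ĝ ≅ G^D`, a homomorphism, whose canonical pairing values on finite points are the Weil characters `⟪y ≫ e, x⟫ = e_q(x ≫ j, y ≫ ĵ)` (★
`weilChar`) — hence natural in `A` (★ `weilHom_natural`) and unique (★ `hom_cartierDual_ext_of_finite`).
[cite: MumfordAV1970, §15 Thm. 1 (p. 143), §20 (pp. 184–186)] [cite: Tate1997FiniteFlatGroupSchemes, §(3.8) p. 145] -/
theorem exists_weilIso : ∃ e : Ĝ ≅ cartierDual G, IsMonHom e.hom ∧
    ∀ ⦃T : Type u⦄ [CommRing T] [Algebra k T] [Module.Finite k T] (y : specOver k T ⟶ Ĝ) (x : specOver k T ⟶ G),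
      cartierPairing G (y ≫ e.hom) x =
        D.weilChar hD (p ^ r) (y ≫ ĵ) (comp_pow_eq_one' (p ^ r) A D Ĝ ĵ hĜ y) (x ≫ j) (comp_pow_eq_one (p ^ r) A G j hG x) := by
  have hq : p ^ r ≠ 0 := pow_ne_zero r (Fact.out : p.Prime).ne_zero
  obtain ⟨w, hw, hpair⟩ := exists_weilHom (p ^ r) A D hD G j hG Ĝ ĵ hĜ
  haveI := hw
  haveI : IsIso w := isIso_weilHom (p ^ r) A D hD G j hG Ĝ ĵ hĜ hq w hpair (finrank_alg_eq_of_dim_eq p r A D hdim G j hG Ĝ ĵ hĜ)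
  exact ⟨asIso w, hw, hpair⟩

end PrimePower

/-! ## §3 The W-line binder shape: closed immersions `j`, `ĵ`; any dual pair via `D.normalize` -/

section WLine

variable (p : ℕ) [Fact p.Prime] (r : ℕ) (A : AbelianVariety k) (D : (AbelianScheme.ofAbelianVariety A).toOver.DualPair)
  (hD : Nonempty ((Scheme.Modules.pullback (DualPair.unitHatSlice D)).obj D.P ≅ SheafOfModules.unit _))
  (hdim : D.hat.toAffine.toAbelianVariety.dim = A.dim)
  (G : SchemeOver k) [GrpObj G] [IsCommMonObj G] [IsAffine G.left] [Module.Free k (Alg G)] [Module.Finite k (Alg G)]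
  (j : G ⟶ A.X) [IsMonHom j] [IsClosedImmersion j.left]
  (hG : ∀ ⦃T : SchemeOver k⦄ (t : T ⟶ A.X), (∃ s : T ⟶ G, s ≫ j = t) ↔ t ≫ ((((p ^ r : ℕ) : ℤ) • 𝟙 A).hom.hom.hom) = 1)
  (Ĝ : SchemeOver k) [GrpObj Ĝ] [IsAffine Ĝ.left] [Module.Finite k (Alg Ĝ)]
  (ĵ : Ĝ ⟶ D.hat.X) [IsMonHom ĵ] [IsClosedImmersion ĵ.left]
  (hĜ : ∀ ⦃T : SchemeOver k⦄ (t : T ⟶ D.hat.X),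
    (∃ s : T ⟶ Ĝ, s ≫ ĵ = t) ↔ t ≫ ((((p ^ r : ℕ) : ℤ) • 𝟙 D.hat.toAffine.toAbelianVariety).hom.hom.hom) = 1)

include hdim hG hĜ in
/-- **THE WEIL ISOMORPHISM, W-LINE BINDERS** (`j`, `ĵ` closed immersions, as in `WeilFamily` of `Cruxes/HLiu418/Lines/F0_P6b_WeilCartierDuality.lean`;
a closed immersion is a monomorphism).  The `WeilFamily`-with-`hdim` value at a NORMALISED dual pair `D` is `Classical.choose` of this statement; at a
general `D`, of the same statement for ★ `D.normalize` (same `Â`, ★ `nonempty_unitHatSlice_iso_normalize`). [cite: MumfordAV1970, §15 Thm. 1 (p. 143), §20 (pp. 184–186)] -/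
theorem exists_weilIso' : ∃ e : Ĝ ≅ cartierDual G, IsMonHom e.hom ∧
    ∀ ⦃T : Type u⦄ [CommRing T] [Algebra k T] [Module.Finite k T] (y : specOver k T ⟶ Ĝ) (x : specOver k T ⟶ G),
      cartierPairing G (y ≫ e.hom) x =
        D.weilChar hD (p ^ r) (y ≫ ĵ) (comp_pow_eq_one' (p ^ r) A D Ĝ ĵ hĜ y) (x ≫ j) (comp_pow_eq_one (p ^ r) A G j hG x) :=
  haveI : Mono j := (Over.forget _).mono_of_mono_map (inferInstanceAs (Mono j.left))
  haveI : Mono ĵ := (Over.forget _).mono_of_mono_map (inferInstanceAs (Mono ĵ.left))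
  exists_weilIso p r A D hD hdim G j hG Ĝ ĵ hĜ

end WLine

end Literature.AlgebraicGeometry.AbelianSchemes.WeilPairing

end
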